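import Summits.FinalStateConjecture.FinalStateConjecture.Theses.NoVacuumStrings
import Summits.FinalStateConjecture.FinalStateConjecture.Theorems.CurvatureOrSymmetryMinimalSingularTipChains
import Literature.Geometry.Lorentzian.LeviCivitaProofs
import HarnessLib

/-!
# Birth skeleton — crux stmt-FinalStateConjecture-12915 `Theses.NoVacuumStrings.NakedModelExists` (rank 3)
# line `birth` (skeleton registrar planner-skel-stmt-FinalStateConjecture-12915-0, 2026-08-17; BC3 of run/shared/lean/lens3/_common/BC.md)

The crux (verbatim the route decl): for every admissible (smooth, complete, one-ended,
asymptotically flat vacuum) datum `D` and every MAXIMAL vacuum Cauchy development `𝒟` of `D` with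
INCOMPLETE future null infinity (Christodoulou's sojourn form, `¬ HasCompleteNullInfinity`) there
is a FIRST NAKED POINT `P` of `𝒟` (`CauchyDevelopment.FirstNakedPoint`: a TIP, visible from the
rays witnessing the incompleteness, `⊆`-minimal among TIPs) and a `C²` tangent profile `(𝓩, P₀)` of
`𝒟` at `P` (`Spacetime.IsTangentProfileAt … 2`) with `P₀` a MINIMAL TIP of `𝓩` and `𝓩` non-flat.

The cut is the route's own foreseen split of this item (route header, TWO-LAYER PLAN:
"NakedModelExists ⇐ FirstNakedTIP → CurvatureScaleCompactness → NakedModelExists (causal-boundary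
theorem; point-picking + gauge + unwrapping + exactness)"), with the causal-boundary half cut once
more along the ORDER-THEORETIC seam that is already a landed theorem of this sub-problem,
`Theorems.cauchyDevelopment_exists_isMinimalTIP_subset_of_seq`
(Theorems/CurvatureOrSymmetryMinimalSingularTipChains: Zorn on TIPs ordered by `⊇` + countable
coinitiality of chains of open sets in the second-countable carrier — a TIP `W₀` contains a
`⊆`-minimal TIP as soon as below every ANTITONE SEQUENCE of TIPs inside `W₀` there is a TIP). The
same seam carries the registered line `first-naked-point-zorn` of the sibling crux
`HomotheticSurfaceGravity.NakedTangentProfile` (stmt-17353); the three stubs below are the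
EXIT-FREE forms of its three pieces (this crux quantifies over ALL admissible data and has no
genericity escape), so a proof of any stub here closes the corresponding piece there a fortiori.

* `stub_visibleEndlessObserver` (A, LOCALISATION; size L/XL): incomplete sojourn-`𝓘⁺` of an MGHD
  of admissible data ⇒ a future-directed timelike curve `γ₀` WITHOUT FUTURE ENDPOINT (an observer
  falling into the singular future boundary) whose whole world-line `γ₀ '' s₀` is VISIBLE FROM
  INFINITY (`IsVisibleFromInfinity`, under the development's Levi-Civita binder). Then
  `W₀ := I⁻(γ₀(s₀))` is a visible TIP ("pasts of visible sets are visible", proved below).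
  Content: exterior stability (Klainerman–Nicolò 2003) confines the ends of the witnessing far rays
  to `J⁺` of a fixed compact region; the visible part of the future boundary has a common past
  containing an endless observer (Rodnianski–Shlapentokh-Rothman picture: the far incoming rays end
  on the Cauchy horizon `C⁺(𝒪)`, every point of which has the infalling observers of `𝒪` in its
  past). Why it might fail: the witnessing rays may end on an extended null front with NO common
  ideal point in their pasts (thunderbolt-like front; several naked points each seen from part of
  the asymptotic region only); the sojourn clause couples `B₀` to the rays.
* `stub_noTIPCascade` (B, NO ZENO CASCADE OF IDEAL POINTS; size L): inside a VISIBLE TIP `W₀` of an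
  MGHD of admissible data, below every antitone sequence `P₀ ⊇ P₁ ⊇ ⋯` of TIPs runs a future-endless
  timelike curve `γ`, `γ '' s ⊆ P k` for all `k` (it generates a TIP below the sequence, proved
  below). Content: the vertices of a descending chain of visible ideal points can recede neither to
  the Cauchy hypersurface nor to infinity (sojourn bounds), nor accumulate at an interior event
  (Cauchy stability / breakdown criterion, arXiv:1204.1767), nor at a non-TIP boundary set. Why it
  might fail: a Zeno cascade of ever-earlier, ever-weaker concentrations `𝒪ₖ`,
  `I⁻(𝒪ₖ₊₁) ⊊ I⁻(𝒪ₖ)`, converging to a boundary set that is no endless observer's past is excluded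
  by no printed theorem outside spherical symmetry.
* `stub_modelAtFirstNakedPoint` (C, CURVATURE-SCALE COMPACTNESS AT EVERY FIRST NAKED POINT; size
  XL/open; the crux's analytic heart): at EVERY first naked point `P` of an MGHD of admissible data
  there is a `C²` tangent profile `(𝓩, P₀)` centred at a MINIMAL TIP `P₀` of `𝓩`, `𝓩` non-flat.
  Content: point-picking at the curvature scale, a gauge controlled by curvature bounds, unwrapping
  of collapse (local covers are allowed by `IsTangentProfileAt`), Type-II exclusion (honest
  centring), non-flatness of a Type-I limit. Why it might fail (the crux's own): no Lorentzian
  Cheeger–Gromov compactness from curvature control; Type-II concentration re-centres the model so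
  `P₀` is no minimal TIP; a bounded-curvature naked boundary (fountain) has only FLAT `C²` models —
  now exposed at EVERY first naked point, not only at one.

Composition `NakedModelExists_of : Sig.A → Sig.B → Sig.C → NakedModelExists` (real proof, no
`sorry`; ~30 lines + 2 causal lemmas + the landed 170-line Zorn reduction it calls): (A) gives a
visible endless observer, `W₀ := I⁻(γ₀(s₀))` is a visible TIP; by (B) and
`exists_isTIP_subset_of_isFutureEndless` every antitone sequence of TIPs inside `W₀` has a TIP
below it, so `cauchyDevelopment_exists_isMinimalTIP_subset_of_seq` yields a minimal TIP `W ⊆ W₀`,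
visible by antitonicity (`IsVisibleFromInfinity.mono`), i.e. a FIRST NAKED POINT
(`IsMinimalTIP.isFirstNakedPoint`) — this intermediate is `exists_firstNakedPoint_of` (= the
route's foreseen `FirstNakedTIP`); (C) at `W` gives the model. Sanity (no `sorry`):
`stub_visibleEndlessObserver_of_crux : NakedModelExists → Sig.A` (A is a WEAKENING of the crux: the
generating curve of a first naked point lies in it and visibility is antitone).

Disproof.lean: none exists for this crux (`ledger crux ls stmt-FinalStateConjecture-12915`: no
workfiles at registration), so there are no `_false_without_` obligations; the refuter audits on
the item (rattack 2026-08-15: `IsMaximal`, AF decay and `IsMinimalTIP` all load-bearing; rreview: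
`C²` convergence ACROSS `∂P₀` is the precision risk) are honoured — every stub keeps `IsMaximal`
and admissibility, and (C) keeps the minimal-TIP centring and `k = 2` verbatim. Negatives index
(`ledger negatives --problem FinalStateConjecture`): no statement about TIPs / visibility / tangent
profiles.
-/

set_option linter.dupNamespace false

noncomputable section

open Set Filter Function
open scoped Manifold ContDiff Topology
open Literature.Geometry.Lorentzian
open Summit.FinalStateConjecture.FinalStateConjecture.Theorems

namespace Summit.FinalStateConjecture.FinalStateConjecture.Cruxes.NakedModelExists.Birth

open Summit.FinalStateConjecture.FinalStateConjecture.Theses.NoVacuumStrings (NakedModelExists)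

/-! ## Legend: the three stub statements as named propositions (verbatim the registered signatures) -/

/-- Statement of `stub_visibleEndlessObserver` (A): the incompleteness of `𝓘⁺` of an MGHD of
admissible data is localised at a visible future-endless timelike curve. -/
def Sig.stub_visibleEndlessObserver : Prop :=
  ∀ (X : Type) [TopologicalSpace X] [ChartedSpace Literature.Geometry.Lorentzian.E3 X] [IsManifold (𝓡 3) ((⊤ : ℕ∞) : WithTop ℕ∞) X] [T2Space X] [SecondCountableTopology X] [ConnectedSpace X], ∀ D ∈ Literature.Geometry.Lorentzian.admissibleVacuumData X, ∀ 𝒟 : Literature.Geometry.Lorentzian.VacuumCauchyDevelopment D, 𝒟.IsMaximal → ¬ Summit.FinalStateConjecture.HasCompleteNullInfinity 𝒟.toCauchyDevelopment → ∃ (γ₀ : ℝ → 𝒟.carrier) (s₀ : Set ℝ), s₀.OrdConnected ∧ 𝒟.metric.IsFutureTimelikeCurveOn 𝒟.timeOrientation γ₀ s₀ ∧ Literature.Geometry.Lorentzian.IsFutureEndless γ₀ s₀ ∧ ∀ [𝒟.metric.HasLeviCivita], 𝒟.metric.IsVisibleFromInfinity 𝒟.timeOrientation 𝒟.embed 𝒟.normal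 (γ₀ '' s₀)

/-- Statement of `stub_noTIPCascade` (B): inside a visible TIP of an MGHD of admissible data, below
every antitone sequence of TIPs runs a future-endless timelike curve. -/
def Sig.stub_noTIPCascade : Prop :=
  ∀ (X : Type) [TopologicalSpace X] [ChartedSpace Literature.Geometry.Lorentzian.E3 X] [IsManifold (𝓡 3) ((⊤ : ℕ∞) : WithTop ℕ∞) X] [T2Space X] [SecondCountableTopology X] [ConnectedSpace X], ∀ D ∈ Literature.Geometry.Lorentzian.admissibleVacuumData X, ∀ 𝒟 : Literature.Geometry.Lorentzian.VacuumCauchyDevelopment D, 𝒟.IsMaximal → ∀ W₀ : Set 𝒟.carrier, 𝒟.metric.IsTIP 𝒟.timeOrientation W₀ → (∀ [𝒟.metric.HasLeviCivita], 𝒟.metric.IsVisibleFromInfinity 𝒟.timeOrientation 𝒟.embed 𝒟.normal W₀) → ∀ P : ℕ → Set 𝒟.carrier, (∀ k, 𝒟.metric.IsTIP 𝒟.timeOrientation (P k)) → (∀ k, P k ⊆ W₀) → Antitone P → ∃ (γ : ℝ → 𝒟.carrier) (s : Set ℝ), s.OrdConnected ∧ 𝒟.metric.IsFutureTimelikeCurveOn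 𝒟.timeOrientation γ s ∧ Literature.Geometry.Lorentzian.IsFutureEndless γ s ∧ ∀ k, γ '' s ⊆ P k

/-- Statement of `stub_modelAtFirstNakedPoint` (C): every first naked point of an MGHD of
admissible data carries a non-flat `C²` tangent profile centred at a minimal TIP. -/
def Sig.stub_modelAtFirstNakedPoint : Prop :=
  ∀ (X : Type) [TopologicalSpace X] [ChartedSpace Literature.Geometry.Lorentzian.E3 X] [IsManifold (𝓡 3) ((⊤ : ℕ∞) : WithTop ℕ∞) X] [T2Space X] [SecondCountableTopology X] [ConnectedSpace X], ∀ D ∈ Literature.Geometry.Lorentzian.admissibleVacuumData X, ∀ 𝒟 : Literature.Geometry.Lorentzian.VacuumCauchyDevelopment D, 𝒟.IsMaximal → ∀ P : Set 𝒟.carrier, 𝒟.toCauchyDevelopment.FirstNakedPoint P → ∃ (𝓩 : Literature.Geometry.Lorentzian.Spacetime.{0} 4) (P₀ : Set 𝓩.carrier), Literature.Geometry.Lorentzian.Spacetime.IsTangentProfileAt 𝒟.toSpacetime P 𝓩 P₀ 2 ∧ 𝓩.metric.IsMinimalTIP 𝓩.timeOrientation P₀ ∧ ∀ [𝓩.metric.HasLeviCivita],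 ¬ 𝓩.metric.leviCivita.IsFlat

/-! ## Registered stubs (`sorry` only here; signatures def-free and self-contained) -/

/-- **A — THE INCOMPLETENESS OF `𝓘⁺` IS LOCALISED AT A VISIBLE ENDLESS OBSERVER.** For an
admissible datum `D` and a maximal vacuum Cauchy development `𝒟` of `D` with incomplete future null
infinity (sojourn form): there is a future-directed timelike curve `γ₀` on an order-connected
parameter set `s₀`, without future endpoint (`IsFutureEndless`), whose image is visible from
infinity (`IsVisibleFromInfinity`: for every compact `B₀` a sojourn bound, and from outside every
compact `B₁` a bounded-sojourn future-incomplete normalised null ray with `γ₀ '' s₀` in the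
chronological past of its future half), the Levi-Civita hypothesis bound inside as in the crux.
Inputs foreseen: asymptotically flat exterior stability (KlainermanNicolo2003) to confine the ends of
the witnessing rays; a common past vertex of the visible future boundary
(RodnianskiShlapentokhRothman2023, p. 3: the far observers meet `C⁺(𝒪)` in finite time). A
WEAKENING of the crux (`stub_visibleEndlessObserver_of_crux`). Why it might fail: a visible null
front with no common ideal point below it. Sources: Christodoulou1999, KlainermanNicolo2003,
RodnianskiShlapentokhRothman2023, HawkingEllis1973CUP §6.8, Penrose1979. Size: L/XL. -/
theorem stub_visibleEndlessObserver : ∀ (X : Type) [TopologicalSpace X] [ChartedSpace Literature.Geometry.Lorentzian.E3 X] [IsManifold (𝓡 3) ((⊤ : ℕ∞) : WithTop ℕ∞) X] [T2Space X] [SecondCountableTopology X] [ConnectedSpace X], ∀ D ∈ Literature.Geometry.Lorentzian.admissibleVacuumData X, ∀ 𝒟 : Literature.Geometry.Lorentzian.VacuumCauchyDevelopment D, 𝒟.IsMaximal → ¬ Summit.FinalStateConjecture.HasCompleteNullInfinity 𝒟.toCauchyDevelopment → ∃ (γ₀ : ℝ → 𝒟.carrier) (s₀ : Set ℝ), s₀.OrdConnected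 ∧ 𝒟.metric.IsFutureTimelikeCurveOn 𝒟.timeOrientation γ₀ s₀ ∧ Literature.Geometry.Lorentzian.IsFutureEndless γ₀ s₀ ∧ ∀ [𝒟.metric.HasLeviCivita], 𝒟.metric.IsVisibleFromInfinity 𝒟.timeOrientation 𝒟.embed 𝒟.normal (γ₀ '' s₀) := by
  sorry

/-- **B — NO ZENO CASCADE OF VISIBLE IDEAL POINTS.** For admissible `D`, a maximal vacuum Cauchy
development `𝒟`, a terminal indecomposable past set `W₀` of `𝒟` (`IsTIP`) which is visible from
infinity (Levi-Civita binder inside), and an ANTITONE sequence `P 0 ⊇ P 1 ⊇ ⋯` of TIPs inside `W₀`: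
some future-directed timelike curve `γ` on an order-connected `s`, without future endpoint, threads
the whole sequence, `γ '' s ⊆ P k` for every `k` — the cascade has an ideal point at its bottom
(`I⁻(γ(s))` is then a TIP below every `P k`, `exists_isTIP_subset_of_isFutureEndless`, which is
exactly the input of the landed Zorn reduction `cauchyDevelopment_exists_isMinimalTIP_subset_of_seq`).
Inputs foreseen: the Cauchy hypersurface and the sojourn bounds (vertices cannot recede to `Σ` or to
infinity), Cauchy stability / the breakdown criterion (ideal points cannot accumulate at an interior
event). Why it might fail: a Zeno cascade of ever-earlier, ever-weaker concentrations converging to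
a boundary set that is no endless observer's past (`⋂ P k` PIP-like or empty) is excluded by no
printed theorem outside spherical symmetry. Sources: HawkingEllis1973CUP §6.8,
GerochKronheimerPenrose1972, Christodoulou1999, arXiv:1204.1767, arXiv:2605.16235. Size: L. -/
theorem stub_noTIPCascade : ∀ (X : Type) [TopologicalSpace X] [ChartedSpace Literature.Geometry.Lorentzian.E3 X] [IsManifold (𝓡 3) ((⊤ : ℕ∞) : WithTop ℕ∞) X] [T2Space X] [SecondCountableTopology X] [ConnectedSpace X], ∀ D ∈ Literature.Geometry.Lorentzian.admissibleVacuumData X, ∀ 𝒟 : Literature.Geometry.Lorentzian.VacuumCauchyDevelopment D, 𝒟.IsMaximal → ∀ W₀ : Set 𝒟.carrier, 𝒟.metric.IsTIP 𝒟.timeOrientation W₀ → (∀ [𝒟.metric.HasLeviCivita], 𝒟.metric.IsVisibleFromInfinity 𝒟.timeOrientation 𝒟.embed 𝒟.normal W₀) → ∀ P : ℕ → Set 𝒟.carrier, (∀ k, 𝒟.metric.IsTIP 𝒟.timeOrientation (P k)) → (∀ k, P k ⊆ W₀) → Antitone P → ∃ (γ : ℝ → 𝒟.carrier) (s : Set ℝ),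 s.OrdConnected ∧ 𝒟.metric.IsFutureTimelikeCurveOn 𝒟.timeOrientation γ s ∧ Literature.Geometry.Lorentzian.IsFutureEndless γ s ∧ ∀ k, γ '' s ⊆ P k := by
  sorry

/-- **C — CURVATURE-SCALE COMPACTNESS: A NON-FLAT, HONESTLY CENTRED `C²` MODEL AT EVERY FIRST NAKED
POINT.** For admissible `D`, a maximal vacuum Cauchy development `𝒟` and EVERY first naked point `P`
of `𝒟` (`CauchyDevelopment.FirstNakedPoint`: TIP, visible from infinity, `⊆`-minimal): there is a
smooth time-oriented `𝓩 : Spacetime 4` and `P₀ ⊆ 𝓩` such that `(𝓩, P₀)` is a `C²` tangent profile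
of `𝒟` at `P` (`IsTangentProfileAt … 2`: scales `ƛₙ ↓ 0`, eventual time-oriented open embeddings
`ψₙ`, `ƛₙ⁻² ψₙ^* g → g_𝓩` in `C²_loc`, `ψₙ⁻¹(P) → P₀`), `P₀` is a MINIMAL TIP of `𝓩` (honest
centring: the model's tip is a first ideal point of the model) and `𝓩` is non-flat (for its
Levi-Civita connection, granted its existence). The route's "CurvatureScaleCompactness":
point-picking at the curvature scale (MorganTian2007 Def. 5.3/5.32 transcribed), a gauge controlled
by curvature bounds, unwrapping of collapse, Type-II exclusion, `ε`-regularity for non-flatness.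
Why it might fail: no Lorentzian Cheeger–Gromov compactness from curvature control (bounded-`L²`
theory continues, does not extract `C²` limits, arXiv:1204.1767); Type-II concentration re-centres
the model (`P₀` no minimal TIP); a bounded-curvature naked boundary (fountain) has only flat `C²`
models; `C²` convergence ACROSS `∂P₀` vs the `C^{1,cε²}` cones of arXiv:1912.08478 Thm 1 — all now
at EVERY first naked point. Sources: MorganTian2007, RodnianskiShlapentokhRothman2023,
RodnianskiShlapentokhrothman2018 Thm 1.2, arXiv:gr-qc/0208079, arXiv:1204.1767, arXiv:2601.04152.
Size: XL / open. -/
theorem stub_modelAtFirstNakedPoint : ∀ (X : Type) [TopologicalSpace X] [ChartedSpace Literature.Geometry.Lorentzian.E3 X] [IsManifold (𝓡 3) ((⊤ : ℕ∞) : WithTop ℕ∞) X] [T2Space X] [SecondCountableTopology X] [ConnectedSpace X], ∀ D ∈ Literature.Geometry.Lorentzian.admissibleVacuumData X, ∀ 𝒟 : Literature.Geometry.Lorentzian.VacuumCauchyDevelopment D, 𝒟.IsMaximal → ∀ P : Set 𝒟.carrier, 𝒟.toCauchyDevelopment.FirstNakedPoint P → ∃ (𝓩 : Literature.Geometry.Lorentzian.Spacetime.{0}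 4) (P₀ : Set 𝓩.carrier), Literature.Geometry.Lorentzian.Spacetime.IsTangentProfileAt 𝒟.toSpacetime P 𝓩 P₀ 2 ∧ 𝓩.metric.IsMinimalTIP 𝓩.timeOrientation P₀ ∧ ∀ [𝓩.metric.HasLeviCivita], ¬ 𝓩.metric.leviCivita.IsFlat := by
  sorry

/-! ## Causal-order lemmas of the composition (no `sorry`) -/

section Visibility

variable {E : Type*} [NormedAddCommGroup E] [NormedSpace ℝ E] {H : Type*} [TopologicalSpace H]
  {I : ModelWithCorners ℝ E H} {M : Type*} [TopologicalSpace M] [ChartedSpace H M]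
  [IsManifold I ∞ M] {X : Type*} [TopologicalSpace X] {g : LorentzianMetric I ∞ M}
  {τ : TimeOrientation g} {ι : X → M} [FiniteDimensional ℝ E] [CompleteSpace E] [g.HasLeviCivita]
  {N : NormalField I ι}

omit [CompleteSpace E] in
/-- The chronological past of a set visible from infinity is visible from infinity (pasts are
past sets; Hawking–Ellis 1973, §6.8, p. 217). -/
theorem isVisibleFromInfinity_chronologicalPast {P : Set M}
    (h : g.IsVisibleFromInfinity τ ι N P) :
    g.IsVisibleFromInfinity τ ι N (g.chronologicalPast τ P) := by
  intro B₀ hB₀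
  obtain ⟨s, hs⟩ := h B₀ hB₀
  refine ⟨s, fun B₁ hB₁ ↦ ?_⟩
  obtain ⟨p, hp, γ, dom, hγ, hbdd, hsoj, hsub⟩ := hs B₁ hB₁
  exact ⟨p, hp, γ, dom, hγ, hbdd, hsoj,
    (LorentzianMetric.chronologicalPast_mono hsub).trans
      (LorentzianMetric.isPastSet_chronologicalPast _)⟩

end Visibility

section TIP

variable {E : Type*} [NormedAddCommGroup E] [NormedSpace ℝ E] {H : Type*} [TopologicalSpace H]
  {I : ModelWithCorners ℝ E H} {n : ℕ∞ω} {M : Type*} [TopologicalSpace M] [ChartedSpace H M]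
  [IsManifold I ∞ M] {g : LorentzianMetric I n M} {τ : TimeOrientation g}

/-- A future-endless timelike curve threading a family of TIPs generates a TIP below all of them
(`I⁻(γ(s))` is a TIP by definition; `γ(s) ⊆ Pₖ` gives `I⁻(γ(s)) ⊆ I⁻(Pₖ) ⊆ Pₖ`). -/
theorem exists_isTIP_subset_of_isFutureEndless {κ : Sort*} {P : κ → Set M}
    (hP : ∀ k, g.IsTIP τ (P k)) {γ : ℝ → M} {s : Set ℝ} (hs : s.OrdConnected)
    (hγ : g.IsFutureTimelikeCurveOn τ γ s) (he : IsFutureEndless γ s) (hsub : ∀ k, γ '' s ⊆ P k) :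
    ∃ W, g.IsTIP τ W ∧ ∀ k, W ⊆ P k :=
  ⟨g.chronologicalPast τ (γ '' s), ⟨γ, s, hs, hγ, he, rfl⟩, fun k ↦
    (LorentzianMetric.chronologicalPast_mono (hsub k)).trans (hP k).isPastSet⟩

end TIP

/-! ## The kernel-checked composition (no `sorry` below this line) -/

/-- **The route's foreseen `FirstNakedTIP`, from A and B**: every maximal vacuum Cauchy development
of admissible data with incomplete sojourn-`𝓘⁺` has a first naked point. (A) gives a visible
endless observer `γ₀`; `W₀ := I⁻(γ₀(s₀))` is a visible TIP; by (B) every antitone sequence of TIPs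
inside `W₀` is threaded by an endless timelike curve, hence has a TIP below it; the landed Zorn
reduction `cauchyDevelopment_exists_isMinimalTIP_subset_of_seq` gives a minimal TIP `W ⊆ W₀`,
visible by antitonicity, i.e. a first naked point (under the development's proof-irrelevant
Levi-Civita binder). -/
theorem exists_firstNakedPoint_of (hA : Sig.stub_visibleEndlessObserver)
    (hB : Sig.stub_noTIPCascade) :
    ∀ (X : Type) [TopologicalSpace X] [ChartedSpace Literature.Geometry.Lorentzian.E3 X] [IsManifold (𝓡 3) ((⊤ : ℕ∞) : WithTop ℕ∞) X] [T2Space X] [SecondCountableTopology X] [ConnectedSpace X], ∀ D ∈ Literature.Geometry.Lorentzian.admissibleVacuumData X, ∀ 𝒟 : Literature.Geometry.Lorentzian.VacuumCauchyDevelopment D, 𝒟.IsMaximal → ¬ Summit.FinalStateConjecture.HasCompleteNullInfinity 𝒟.toCauchyDevelopment → ∃ P : Set 𝒟.carrier, 𝒟.toCauchyDevelopment.FirstNakedPoint P := by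
  intro X _ _ _ _ _ _ D hD 𝒟 hmax hinc
  -- (A): a visible endless observer
  obtain ⟨γ₀, s₀, hs₀, hγ₀, he₀, hvis₀⟩ := hA X D hD 𝒟 hmax hinc
  -- the Levi-Civita connection of the smooth metric exists; all instances are proof-irrelevant
  haveI hLC : 𝒟.metric.HasLeviCivita := 𝒟.metric.hasLeviCivita
  -- `W₀ := I⁻(γ₀(s₀))` is a visible TIP
  set W₀ : Set 𝒟.carrier := 𝒟.metric.chronologicalPast 𝒟.timeOrientation (γ₀ '' s₀) with hW₀def
  have hW₀ : 𝒟.metric.IsTIP 𝒟.timeOrientation W₀ := ⟨γ₀, s₀, hs₀, hγ₀, he₀, rfl⟩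
  have hW₀vis : ∀ [𝒟.metric.HasLeviCivita],
      𝒟.metric.IsVisibleFromInfinity 𝒟.timeOrientation 𝒟.embed 𝒟.normal W₀ :=
    fun {_} ↦ isVisibleFromInfinity_chronologicalPast hvis₀
  -- (B): no cascade inside `W₀`, in the form consumed by the Zorn reduction
  have hchain : ∀ P : ℕ → Set 𝒟.carrier, (∀ k, 𝒟.metric.IsTIP 𝒟.timeOrientation (P k)) →
      (∀ k, P k ⊆ W₀) → Antitone P →
        ∃ W, 𝒟.metric.IsTIP 𝒟.timeOrientation W ∧ ∀ k, W ⊆ P k := by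
    intro P hP hPW hanti
    obtain ⟨γ, s, hs, hγ, he, hsub⟩ := hB X D hD 𝒟 hmax W₀ hW₀ hW₀vis P hP hPW hanti
    exact exists_isTIP_subset_of_isFutureEndless hP hs hγ he hsub
  -- Zorn on TIPs + countable coinitiality: a minimal TIP inside `W₀`
  obtain ⟨W, hWW₀, hmin⟩ :=
    cauchyDevelopment_exists_isMinimalTIP_subset_of_seq 𝒟.toCauchyDevelopment hW₀ hchain
  -- which is visible (antitonicity), hence a first naked point of `𝒟`
  exact ⟨W, fun {_} ↦ hmin.isFirstNakedPoint (hW₀vis.mono hWW₀)⟩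

/-- **`NakedModelExists` from the three stubs, hypothesis form** (the implication shape
`A → B → C → NakedModelExists`; no `sorry` in this declaration): a first naked point exists by
`exists_firstNakedPoint_of` (A, B and the landed Zorn reduction), and (C) supplies the non-flat,
minimal-TIP-centred `C²` model there. The conclusion is the route decl BY NAME. -/
theorem NakedModelExists_of :
    Sig.stub_visibleEndlessObserver → Sig.stub_noTIPCascade → Sig.stub_modelAtFirstNakedPoint →
      NakedModelExists := by
  intro hA hB hC X _ _ _ _ _ _ D hD 𝒟 hmax hinc
  -- Step 1 (A + B + Zorn): a first naked point `P` of `𝒟`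
  obtain ⟨P, hfirst⟩ := exists_firstNakedPoint_of hA hB X D hD 𝒟 hmax hinc
  -- Step 2 (C): blow up at `P`
  obtain ⟨𝓩, P₀, htan, hminP₀, hnf⟩ := hC X D hD 𝒟 hmax P hfirst
  exact ⟨P, hfirst, 𝓩, P₀, htan, hminP₀, hnf⟩

/-- The crux by name, closed modulo the three registered stubs (checks that the `Sig.*` legend is
the stub signatures verbatim). -/
theorem nakedModelExists_of_stubs : NakedModelExists :=
  NakedModelExists_of stub_visibleEndlessObserver stub_noTIPCascade stub_modelAtFirstNakedPoint

/-! ## Sanity (no `sorry`): A is a genuine WEAKENING of the crux -/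

/-- The crux implies A: the generating curve of a first naked point `P = I⁻(γ(s))` lies in `P`
(`image_subset_chronologicalPast_of_isFutureEndless`) and visibility from infinity is antitone. -/
theorem stub_visibleEndlessObserver_of_crux (h : NakedModelExists) :
    Sig.stub_visibleEndlessObserver := by
  intro X _ _ _ _ _ _ D hD 𝒟 hmax hinc
  obtain ⟨P, hP, -⟩ := h X D hD 𝒟 hmax hinc
  -- the Levi-Civita connection of the smooth metric exists; all instances are proof-irrelevant
  haveI hLC : 𝒟.metric.HasLeviCivita := 𝒟.metric.hasLeviCivita
  have hP' := (CauchyDevelopment.firstNakedPoint_iff 𝒟.toCauchyDevelopment P).mp hP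
  obtain ⟨γ, s, hs, hγ, he, rfl⟩ := hP'.isTIP
  refine ⟨γ, s, hs, hγ, he, fun {_} ↦ ?_⟩
  exact hP'.isVisibleFromInfinity.mono
    (LorentzianMetric.image_subset_chronologicalPast_of_isFutureEndless hs hγ he)

end Summit.FinalStateConjecture.FinalStateConjecture.Cruxes.NakedModelExists.Birth

end
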